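import Mathlib
import HarnessLib
import Summits.Ventures.LatticeQCDFlow.Exactness.SphereFamilyLeapfrogHMCErgodic
import Summits.Ventures.LatticeQCDFlow.Exactness.CPNSymanzikErgodic

/-!
# Single-step geodesic leapfrog HMC on a family of spheres for ANY continuous action and force — and the `cpn_2d` Symanzik-improved (`symanzik-tree`) instance

HONEST FRAMING: exact (Metropolis-corrected) sampling algorithms for lattice gauge theory;
figures of merit are autocorrelation/cost numbers at stated couplings and volumes; no
continuum-physics claim.

Venture `LatticeQCDFlow` (cell pub-lqcd), topic `Exactness`, FANOUT row 9 (eng-latcore, the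
engine `latflow.core.cpn_2d.HMCCPN` with `action = "symanzik"`: the two-link improved action of
`CPNField2D.bond_terms`).  NEW WORK of the cell over the tree: part 3 of the gen-16 chain
(`SphereFamilyLeapfrogHMCErgodic.lean`: `famLeapfrogHMC_uniformlyErgodic` / `_invariant_unique` for
bounded measurable action and force), part 1b (`famLeapfrogHMC_invariant`, `famGibbsLaw`), gen-12's
`CPNSymanzikErgodic.lean` (`cpnAction₂`, `continuous_cpnAction₂`, `cpn₂GibbsLaw`) and
`HeatBathSweepErgodic.lean` (`piGibbsLaw`), `HeatBathSweepCompact.lean` (`gibbsDensity`).  Nothing is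
cited as a fact.

The configuration space of a finite family of spheres is compact, so a CONTINUOUS action is bounded
and a CONTINUOUS force field is bounded: the hypotheses of part 3 are automatic.  This file records
that corollary once (any family, any continuous `S`, `F`) and instantiates it for the engine's second
action token.

## Content

* §1 (any family `k : ι → ℕ`): `exists_abs_le_of_continuous_fam`, `exists_norm_le_of_continuous_fam`
  (compactness), `famGibbsLaw_eq_piGibbsLaw` (`famGibbsLaw S = piGibbsLaw (uniformSphere) (gibbsDensity S)`),
  **`famLeapfrogHMC_uniformlyErgodic_of_continuous`**, **`famLeapfrogHMC_invariant_unique_of_continuous`**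
  — for every continuous action and continuous coupled force field and every `δ > 0`, the `nstep = 1`
  kernel converges to `piGibbsLaw (⊗ uniformSphere) e^{−S}` from EVERY start, which is its unique
  invariant probability law.
* §2 (`k = cpnDim V E d`, `S = cpnAction₂`): **`cpn₂_leapfrogHMC_invariant`** (exact, every `nstep`),
  **`cpn₂_leapfrogHMC_uniformlyErgodic`**, **`cpn₂GibbsLaw_unique_invariant_leapfrogHMC`**.

NOT CLAIMED: `nstep ≥ 2` ergodicity; rates; floating point; the engine's improvement coefficients
(abstract weights `c₂`, as in `CPNSymanzikErgodic.lean`).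
-/

noncomputable section

namespace Summit.Ventures.LatticeQCDFlow.Exactness

open MeasureTheory Measure Metric Set Real ProbabilityTheory
open scoped ENNReal InnerProductSpace

/-! ## §1 Continuous action and force on a family of spheres -/

section Family

variable {ι : Type*} [Fintype ι] {k : ι → ℕ}

omit [Fintype ι] in
/-- A continuous action on the (compact) configuration space of a family of spheres is bounded. -/
theorem exists_abs_le_of_continuous_fam {S : (Π i, FamS k i) → ℝ} (hS : Continuous S) :
    ∃ s : ℝ, ∀ x, |S x| ≤ s := by
  obtain ⟨s, hs⟩ := isCompact_univ.exists_bound_of_continuousOn hS.continuousOn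
  exact ⟨s, fun x => by simpa [Real.norm_eq_abs] using hs x (mem_univ x)⟩

/-- A continuous force field on the configuration space of a family of spheres is bounded, index by
index, by a non-negative constant. -/
theorem exists_norm_le_of_continuous_fam {F : (Π i, FamS k i) → (Π i, FamE k i)} (hF : Continuous F) :
    ∃ b : ℝ, 0 ≤ b ∧ ∀ x i, ‖F x i‖ ≤ b := by
  obtain ⟨b, hb⟩ := isCompact_univ.exists_bound_of_continuousOn hF.continuousOn
  exact ⟨b, (norm_nonneg _).trans (hb (fun _ => sphereDefault) (mem_univ _)),
    fun x i => (norm_le_pi_norm (F x) i).trans (hb x (mem_univ x))⟩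

/-- The two spellings of the Gibbs law of an action on a family of spheres agree:
`famGibbsLaw S = piGibbsLaw (⊗ uniformSphere) (gibbsDensity S)`. -/
theorem famGibbsLaw_eq_piGibbsLaw (S : (Π i, FamS k i) → ℝ) :
    famGibbsLaw (k := k) S =
      piGibbsLaw (fun i => uniformSphere (volume : Measure (FamE k i))) (gibbsDensity S) := by
  rw [famGibbsLaw, piGibbsLaw, withDensity_apply _ MeasurableSet.univ, Measure.restrict_univ]
  rfl

/-- **SINGLE-STEP GEODESIC LEAPFROG HMC WITH A CONTINUOUS ACTION AND A CONTINUOUS FORCE CONVERGES FROM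
EVERY START** to `piGibbsLaw (⊗ uniformSphere) e^{−S}`, geometrically in total variation, for every
step `δ > 0` (boundedness of `S` and `F` by compactness; part 3). -/
theorem famLeapfrogHMC_uniformlyErgodic_of_continuous {F : (Π i, FamS k i) → (Π i, FamE k i)}
    (hF : Continuous F) {δ : ℝ} (hδ : 0 < δ) {S : (Π i, FamS k i) → ℝ} (hS : Continuous S) :
    ∃ η : ℝ, 0 < η ∧ η ≤ 1 ∧ ∀ (μ₀ : Measure (Π i, FamS k i)) [IsProbabilityMeasure μ₀] (t : ℕ)
      (A : Set (Π i, FamS k i)),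
      |((fun m : Measure (Π i, FamS k i) => m.bind (famLeapfrogHMC F δ 1 hF.measurable S))^[t] μ₀).real A
          - (piGibbsLaw (fun i => uniformSphere (volume : Measure (FamE k i))) (gibbsDensity S)).real A|
        ≤ (1 - η) ^ t := by
  obtain ⟨s, hs⟩ := exists_abs_le_of_continuous_fam hS
  obtain ⟨b, hb0, hb⟩ := exists_norm_le_of_continuous_fam hF
  rw [← famGibbsLaw_eq_piGibbsLaw]
  exact famLeapfrogHMC_uniformlyErgodic hδ hF.measurable hb0 hb hS.measurable hs

/-- **… and that law is the unique invariant probability law** of the kernel. -/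
theorem famLeapfrogHMC_invariant_unique_of_continuous {F : (Π i, FamS k i) → (Π i, FamE k i)}
    (hF : Continuous F) {δ : ℝ} (hδ : 0 < δ) {S : (Π i, FamS k i) → ℝ} (hS : Continuous S)
    {π' : Measure (Π i, FamS k i)} [IsProbabilityMeasure π']
    (hπ' : Kernel.Invariant (famLeapfrogHMC F δ 1 hF.measurable S) π') :
    π' = piGibbsLaw (fun i => uniformSphere (volume : Measure (FamE k i))) (gibbsDensity S) := by
  obtain ⟨s, hs⟩ := exists_abs_le_of_continuous_fam hS
  obtain ⟨b, hb0, hb⟩ := exists_norm_le_of_continuous_fam hF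
  rw [← famGibbsLaw_eq_piGibbsLaw]
  exact famLeapfrogHMC_invariant_unique hδ hF.measurable hb0 hb hS.measurable hs hπ'

end Family

/-! ## §2 The `cpn_2d` Symanzik-improved action -/

section Symanzik

variable {V E P : Type*} [Fintype V] [Fintype E] [Fintype P] {d : ℕ}
  {src tgt : E → V} {J : EuclideanSpace ℝ (Fin (d + 2)) →L[ℝ] EuclideanSpace ℝ (Fin (d + 2))} {c : E → ℝ}
  {e₁ e₂ : P → E} {s t : P → V} {c₂ : P → ℝ}
  {F : CPNConfig V E d → (Π i, FamE (cpnDim V E d) i)}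

/-- **THE `cpn_2d` HMC FOR THE SYMANZIK-IMPROVED ACTION IS EXACT** at every trajectory length `n`,
step `δ` and for every measurable force field: `e^{−S₂} · ⊗ cpnRef` is invariant. -/
theorem cpn₂_leapfrogHMC_invariant (hF : Measurable F) (δ : ℝ) (n : ℕ) :
    Kernel.Invariant (famLeapfrogHMC (k := cpnDim V E d) F δ n hF (cpnAction₂ src tgt J c e₁ e₂ s t c₂))
      ((Measure.pi (cpnRef V E d)).withDensity (gibbsDensity (cpnAction₂ src tgt J c e₁ e₂ s t c₂))) :=
  famLeapfrogHMC_invariant hF δ n (continuous_cpnAction₂ src tgt J c e₁ e₂ s t c₂).measurable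

/-- **THE `cpn_2d` HMC FOR THE SYMANZIK-IMPROVED ACTION AT `nstep = 1` CONVERGES TO THE IMPROVED-ACTION
LATTICE LAW FROM EVERY START**, for every continuous force field and every `δ > 0`. -/
theorem cpn₂_leapfrogHMC_uniformlyErgodic (hF : Continuous F) {δ : ℝ} (hδ : 0 < δ) :
    ∃ η : ℝ, 0 < η ∧ η ≤ 1 ∧ ∀ (μ₀ : Measure (CPNConfig V E d)) [IsProbabilityMeasure μ₀] (n : ℕ)
      (A : Set (CPNConfig V E d)),
      |((fun m : Measure (CPNConfig V E d) =>
          m.bind (famLeapfrogHMC (k := cpnDim V E d) F δ 1 hF.measurable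
            (cpnAction₂ src tgt J c e₁ e₂ s t c₂)))^[n] μ₀).real A
          - (cpn₂GibbsLaw src tgt J c e₁ e₂ s t c₂).real A| ≤ (1 - η) ^ n :=
  famLeapfrogHMC_uniformlyErgodic_of_continuous hF hδ (continuous_cpnAction₂ src tgt J c e₁ e₂ s t c₂)

/-- **The improved-action lattice law is the unique invariant probability law** of that kernel. -/
theorem cpn₂GibbsLaw_unique_invariant_leapfrogHMC (hF : Continuous F) {δ : ℝ} (hδ : 0 < δ)
    {π' : Measure (CPNConfig V E d)} [IsProbabilityMeasure π']
    (hπ' : Kernel.Invariant (famLeapfrogHMC (k := cpnDim V E d) F δ 1 hF.measurable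
      (cpnAction₂ src tgt J c e₁ e₂ s t c₂)) π') :
    π' = cpn₂GibbsLaw src tgt J c e₁ e₂ s t c₂ :=
  famLeapfrogHMC_invariant_unique_of_continuous hF hδ (continuous_cpnAction₂ src tgt J c e₁ e₂ s t c₂) hπ'

end Symanzik

end Summit.Ventures.LatticeQCDFlow.Exactness

end
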